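import Summits.ABC.IUTFork.Conditional.Layer5OfSEx51
import Literature.IUT.HodgeTheaters.FKitCoreBridgeCanonical
import Literature.IUT.HodgeTheaters.GlobalFrobenioidsCoricRigidityOfFixedDivisors
import Literature.IUT.HodgeTheaters.GlobalFrobenioidsInfKappaDeterminesProofs
import Literature.IUT.HodgeTheaters.TemperedCoveringsCor23iiOfSpecialFibre
import HarnessLib

/-!
# Layer-5 certificate, ADDITIVE PART v0.2 — binder WEAKENING / FACT removal only, plus the E51/L31 conjunct
# (director-abc (C2); plan/L5/LAYER5-CERT-SPEC.md §7; abc-iut-L5-lead (gen 4) GO 07:39:57Z; writer abc-iut-L5-d1 gen 5)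

cert L5 v0.2 additive part (one module, PROOF-ONLY: no `def`, no `instance`, no `axiom`, no `sorry`, no `notation`; every
input BY NAME; nothing of `Conditional/Layer5OfS.lean` (v0, p430789), `Conditional/Layer5OfSData.lean` (p430066) or
`Conditional/Layer5OfSEx51.lean` (v0.1, p431142) is touched).  Three held blocks RESTATED WITH FEWER / WEAKER binders and
ONE new closed conjunct, then the single top of record `layer5_of_S_v2`:

* (a) `layer5_held_cor56i_ref` — [IUTchI] Cor 5.6 (i), the FROZEN node statement `BaseThetaDatum.S5Local.Cor56i S`, with the
  (ε)-binder in its REFERENCE-THEATER form `hHT : (fc.ht S.HT).IsCanonical` (closer abc-iut-w5-d217's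
  `S5Local.FKitCore.cor56i_of_canonical_laws_ref`, `FKitCoreBridgeCanonical.lean` p427470/p428577, re-landed comment-only
  p431688 to dispatch its build).  **ERRATUM F-d5-1** (abc-iut-L5-d5 g5, accepted by abc-iut-L5-lead 07:35:42Z / 07:37Z):
  v0's `layer5_held_cor56i` carries `hcan : ∀ H : FK.ThetaHT, H.IsCanonical` ((ε) for EVERY kit theater), which is STRICTLY
  STRONGER than `hHT` — NOT «equivalent given `hnat`» as v0's docstring l.339–342 says: `FKitCore.isCanonical_ht_of_ref`
  (`hnat ∧ hHT ⇒` canonicity) concludes only on the IMAGE of `fc.ht`, and `FKitCore.ht` is not essentially surjective by any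
  field.  This theorem is the reference-theater form OF RECORD (RULINGS #33 (3) ruling (b); the READY bytes b16147da4e4cf478,
  countersigned, verbatim up to the name); v0's `hcan` form stays in the tree as the ruling-(a)-strength statement.  WEAKENS v0
  conjunct `StatementOf @layer5_held_cor56i` by the binder `hcan ↦ hHT`; count unchanged (7: he · h02 · h53ii · h53iv · hfaith ·
  hnat · hHT).
* (b) `layer5_held_ex51v_v2` — [IUTchI] Ex 5.1 (v): the EIGHT closed conjuncts of v0.1's `layer5_held_ex51v` (author of record
  abc-iut-w5-d110) with conjunct 1 (E51/L29, ∞κ) RE-POINTED to abc-iut-w5-d110's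
  `NFBridgeRecon.existsUniqueCoricStructure_infκPair_of_fixedDivisors` (p431147): the divisor laws (b′) / Rmk 3.1.7 (i)(ii) are
  read on the `π₁^rat`-FIXED ∞κ-coric functions («Kummer classes of RATIONAL functions», p.127 l.76 – p.128 l.2), exactly as
  conjunct 2 (∞κ×) already was ⇒ **the FACT binder `hF_2571 : N.MκIsInvariants` DISAPPEARS (FACT 1 → 0)**; `h_Ex51v_ord` and
  `h_Ex51v_zero` take the fixed phrasing; and two v0.1 law binders become DERIVED, hence dropped: `h_Ex51v_pole` (the ∞κ pole
  law) follows from `h_Ex51v_polex` (the ∞κ× pole law) and `h_Ex51v_zerox` (an invariant ∞κ×-coric function with two zeroes)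
  follows from the fixed-phrased `h_Ex51v_zero`, both via the interface inclusion `NFBridgeRecon.minfκ_subset : 𝕄^⊛_∞κ ⊆ 𝕄^⊛_∞κ×`
  ([IUTchI] Ex 5.1 (i) p.124) — pure logic, no new input.  PLUS a NINTH conjunct, sub-DAG row **E51/L31** («any ∞κ×-coric
  structure determines an ∞κ-coric structure», p.129 l.5–24; «NOT TYPABLE at v0.1»): `CoricPair.DeterminesInfκStructure κx.toFun R N.infκPair`
  at the model ∞κ×-pair with its Kummer realisation `κx` and restriction data `R : CriticalRestrictionData N.piRat H` (text of the
  author of record abc-iut-w5-d110, 4e919baf55567098) from the two LAW binders `h_Ex51v_tors_some` / `h_Ex51v_tors_every` = the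
  Rmk 3.1.7 (ii) TORSION CRITERION read through `R` (closer abc-iut-w5-d110's `NFBridgeRecon.determinesInfκStructure_infκxPair_of_criterion`, `GlobalFrobenioidsInfKappaDeterminesProofs.lean`
  p430736; model form of the criterion PROVED at abc-iut-L5-t2's typing, `CriticalLocus.inftyKappaUnitCoricCriterion_holds`).
  WEAKENS v0.1 conjunct `StatementOf @layer5_held_ex51v`: same 8 closed conjuncts, binders FACT 1 → 0 · LAW 21 → 19
  (−`h_Ex51v_pole`, −`h_Ex51v_zerox`; `h_Ex51v_nat` KEPT — see (d) below); conjunct 9 is NEW coverage with LAW +2 (21 in all).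
* (c) `layer5_held_sec2_v2` — [IUTchI] §2 held rows at the GENUINE 𝔛-datum `StableCurveTemperedData.ofSpecialFibre …`: v0.1's
  `layer5_held_sec2_v1` (abc-iut-L5-d5's reduced route) with the Cor 2.3 (ii) merge atom **`hker` DISCHARGED** by abc-iut-w4-d058's
  `StableCurveTemperedData.ofSpecialFibre_ker_ρHat_subset_closure` (`TemperedCoveringsCor23iiOfSpecialFibre.lean` p431082:
  `Ker(ρ̂ : Δ̂_X ↠ Π̂_𝔾)` ⊆ closure of `ι_Δ(Δ^tp_X) ∩ Ker ρ̂`, by right exactness of profinite completion along the OPEN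
  admissible quotient, [SemiAnbd] Ex. 3.10).  WEAKENS v0.1 conjunct `StatementOf @layer5_held_sec2_v1`: same conjuncts, LAW
  11 → 10 (h22 · hH · hOutTp · hA' · hB' · hv · htp · hhat · h24i · h24ii).
* NOT in v0.2 (lead items (d)/(e), «if landed+built, else omit»): (d) abc-iut-w4-d056's discharge of law (a) at the GENUINE
  Kummer map — `NFBridgeRecon.existsUniqueCoricStructure_infκPair_kummerMap` (p432037 ✓, F-2571-free AND `hnat`-free, universe 0;
  recommended for conjunct 1 by the author of record abc-iut-w5-d110 08:15:05Z) — had NO OLEAN at READY time (importer probe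
  «remote:stale:…:unbuilt»); the variant of this module with conjunct 1 re-pointed to it is kernel-clean in a combined scratch
  (HOME/staging/L5/L5-d1g5/cert/Layer5OfSV02_B.lean) and is the next additive part the minute that olean serves; (e) abc-iut-L5-t11's
  (r2) `h24i`/`h24ii` reductions wait on `StableCurveTemperedDataOfSpecialFibreTower` (p427758, review-pending).  Recorded for the NV
  paragraph (abc-iut-w5-d110, p432142 `NFBridgeRecon.not_laws_of_commutative`): the row-1116 law set (a)+(b′)+zeroes+moves has NO model
  with abelian `π₁^rat` — witnesses must be non-abelian, as the genuine centre-free `Gal(L̄_C/L_C)`; a tightness datum, not a refutation.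

CENSUS v0.2 (BINDER CONVENTION of RULINGS #40 (1): «CONE n · FACT m» = Prop binders INSIDE the held conjuncts; the top theorem
has 0 explicit binders; a binder feeding several conjuncts counts once; data binders / instance atoms not counted; the 8 datum
side-conditions of v0 unchanged): on the MOST-REDUCED routes now in the tree — sec2_v2 10 · sec6 1 · prop67 1 · cor56i_ref 7 ·
cor12 6 · ex51v_v2 21 (19 + L31 2) · ex51i_L11 1 = **CONE 47 · FACT 0** (v0.1: CONE 48 [reduced route] · FACT 1; like-for-like on
v0.1's conjuncts: CONE 45 · FACT 0).  Nodes 139 (claim-proved 47 · data 56 · held/pending 36 [conjoined 16 · not typable /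
settled 20]) unchanged; sub-DAG row E51/L31 moves ∅ → CLOSED modulo the typed torsion criterion.  S-FREE (no [IUTchI] node
consumes `Cor312.PilotKummerIndRelated`).  Post-freeze-additive / proof-only modules imported for closers (not cone members):
FKitCoreBridgeCanonical (p427470+p428577; re-land p431688), GlobalFrobenioidsCoricRigidityOfFixedDivisors (p431147),
GlobalFrobenioidsInfKappaDeterminesProofs (p430736), TemperedCoveringsCor23iiOfSpecialFibre (p431082) — all proof-only.

Mochizuki, *Inter-universal Teichmüller theory I: construction of Hodge theaters*, kurims manuscript (May 2020)
[cite: Mochizuki2012] (D-0012 claim key; series status DISPUTED).  HONEST FRAMING: nothing in this file asserts that abc is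
proved or refuted or takes a side on [IUTchIII] Cor. 3.12 (nor on [IUTchI]); every binder is an ASSUMPTION LABEL (a law
instance at the genuine object, or an L1/L2/L3/L4 merge atom), not an endorsement; every conjunct is a CLOSED statement obtained
by applying a LANDED closer BY NAME; typed ≠ inhabited ≠ discharged; indexed ≠ endorsed; establishment = OUR kernel check only.
Every later version only REMOVES binders (law instance PROVED in tree) or SPLITS one into strictly weaker named ones.
Second readers: abc-iut-L5-d5 g5 ((c)(d) + counts), abc-iut-L5-t16 g5 ((a)(b)(e)).
-/

namespace Summit.ABC.IUTFork.Conditional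

open CategoryTheory Literature.IUT.HodgeTheaters ProfiniteGrp ProfiniteGrp.ProfiniteCompletion
open Literature.AnabelianGeometry.EtaleTheta Literature.AnabelianGeometry.EtaleTheta.ZHatLevel

universe u v w'

/-! ## (a) Cor 5.6 (i) with the reference-theater (ε)-binder — ERRATUM F-d5-1 -/

/-- **Class (c), [IUTchI] §5 — HELD row Cor 5.6 (i), the FROZEN node statement `BaseThetaDatum.S5Local.Cor56i S`, REFERENCE-THEATER
FORM OF RECORD** (RULINGS #33 (3) ruling (b); READY bytes b16147da4e4cf478).  DATA binders (interface atoms; the genuine Ex 3.5 `Glob`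
and the law there are abc-iut-w5-d217's theorem target): abc-iut-L5-t3's §5 local system `S : S5Local 𝔡` over a base datum `𝔡`, a
kit core `c : 𝔡.KitCore K`, an `ℱ`-prime-strip kit `FK : K.FKit M` and its core agreement `fc : S.FKitCore c FK`.  LAW / instance
binders BY NAME: `he` (surjective place dictionary) · `h02 : FK.ThToFBijOnGood` · `h53ii : FK.IsomFtoDBijective` (Cor 5.3 (ii)) ·
`h53iv : FK.AutTemperedBijective` (Cor 5.3 (iv)) · `hfaith : FK.RlfIsoFaithful` (⇐ `ComponentIsoInjective` at the genuine `Glob`,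
Rmk 5.2.1 (ii); GAP G-w5d217-1) · `hnat : FK.RlfOfNatural` ((ε) functoriality) · `hHT : (fc.ht S.HT).IsCanonical` ((ε) at the
reference theater ALONE).  Closer OF RECORD BY NAME: abc-iut-w5-d217's `BaseThetaDatum.S5Local.FKitCore.cor56i_of_canonical_laws_ref`
(p427470; tightness `HodgeTheaterModel.not_cor56iKitCanonical_unitsLink` shows `RlfOfNatural` is necessary).
**ERRATUM F-d5-1:** v0's `layer5_held_cor56i` (p430789) has `hcan : ∀ H : FK.ThetaHT, H.IsCanonical` in place of `hHT`; that binder is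
STRICTLY STRONGER than `hHT` (not equivalent given `hnat` — `FKitCore.isCanonical_ht_of_ref` yields canonicity on the image of `fc.ht`
only; KERNEL WITNESS and characterisation by abc-iut-w5-d217, `FKitCanonicalStrictness.lean` p432524/p432613:
`PMBaseKit.not_forall_isCanonical_of_laws_refCanonical` and `FKitCore.forall_isCanonical_iff_ref_and_rlfIsoLifts` — over `hnat`,
`hcan ⟺ hHT ∧ FK.RlfIsoLifts`, i.e. v0's extra assumption is exactly row L03b); this is the countersigned reference-theater form
(abc-iut-L5-lead RULINGS #33 (3) ruling (b), correction of record 07:35:42Z).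
Nothing here asserts that abc is proved or refuted or takes a side on [IUTchIII] Cor. 3.12; a binder is an assumption label. -/
theorem layer5_held_cor56i_ref {𝔡 : BaseThetaDatum} (S : BaseThetaDatum.S5Local 𝔡) {K : PMBaseKit 𝔡.l} {c : 𝔡.KitCore K}
    {M : K.MultKit} {FK : K.FKit M} (fc : S.FKitCore c FK) (he : Function.Surjective c.e)
    (h02 : FK.ThToFBijOnGood) (h53ii : FK.IsomFtoDBijective) (h53iv : FK.AutTemperedBijective)
    (hfaith : FK.RlfIsoFaithful) (hnat : FK.RlfOfNatural) (hHT : (fc.ht S.HT).IsCanonical) :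
    BaseThetaDatum.S5Local.Cor56i S :=  -- IUTchI:Cor5.6(i)
  fc.cor56i_of_canonical_laws_ref he h02 h53ii h53iv hfaith hnat hHT

/-! ## (b) Ex 5.1 (v): FACT binder F-2571 removed, two law binders derived, + E51/L31 -/

/-- **Row 1116, node `IUTchI:Ex5.1(v)`, v0.2** (class (c)) ([IUTchI] Ex 5.1 (v) pp.127–129), CLOSED CONJUNCTS from LAW-INSTANCE
BINDERS — v0.1's `layer5_held_ex51v` (author of record abc-iut-w5-d110) with: conjunct 1 (∞κ, E51/L29) via
`NFBridgeRecon.existsUniqueCoricStructure_infκPair_of_fixedDivisors` (p431147: laws (b′) `h_Ex51v_ord`, Rmk 3.1.7 (i)/(ii) pole/zero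
shape read on the `π₁^rat`-FIXED ∞κ-coric functions — NO `MκIsInvariants` = F-2571 input); the ∞κ pole law DERIVED from the ∞κ×
one `h_Ex51v_polex` and the ∞κ× two-zeroes witness DERIVED from the ∞κ one `h_Ex51v_zero` through `NFBridgeRecon.minfκ_subset`
(`𝕄^⊛_∞κ ⊆ 𝕄^⊛_∞κ×`, Ex 5.1 (i)); conjuncts 2–8 and their closers verbatim as v0.1 (p424116 `…_infκxPair_of_divisors`, p424820
`UniqueCyclotomeIso.of_laws`, p427568 `UniqueCyclotomeIsoFamily.of_integral_laws`, p413972, p407751); NEW conjunct 9 = E51/L31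
`CoricPair.DeterminesInfκStructure κx.toFun R N.infκPair` («any ∞κ×-coric structure determines an ∞κ-coric structure», read at the
model ∞κ×-pair with its Kummer realisation `κx`; text of the author of record abc-iut-w5-d110) from the Rmk 3.1.7 (ii) torsion
criterion `h_Ex51v_tors_some`/`h_Ex51v_tors_every` (closer p430736 `NFBridgeRecon.determinesInfκStructure_infκxPair_of_criterion`).
Data binders: the reconstruction output `N` (L4 [AbsTopIII] Thm 1.9 merge), a Kummer container `H` with its `π₁^rat`- and
`Ẑ^×`-actions and the Kummer realisations `κ`/`κx` of the two model pairs (L2 Kummer-map merge, GAP G-w4d056-2), an order map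
`ord` ([AbsTopIII] Prop 1.6 (iii)), the cyclotome comparison data `C` (∞κ case) and `Cf` (`†𝕄^⊛` case with layers `⊛/sol/mod` and
integral submonoids `𝒪^⊿_𝔭`), and for E51/L31 the Kummer restriction data `R` on the container `H` (open subgroups of decomposition groups of
strictly critical points).  Law binders (21): (a) Kummer naturality ×2;
(b′) divisor transport ×2; Rmk 3.1.7 pole law (∞κ×, fixed) + two-zeroes witness (∞κ, fixed) + `h_Ex51v_moves`; (E)(T)(D)+Rmk 3.1.7 for
`C` ×6; (E)(T)(V)(I)(P) for `Cf` ×6; torsion criterion ×2.  FACT binders: none.  Nothing here asserts that abc is proved or refuted or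
takes a side on [IUTchIII] Cor. 3.12; a binder is an assumption label; typed ≠ discharged. -/
theorem layer5_held_ex51v_v2 (N : NFBridgeRecon.{u})
    -- DATA: Kummer container and realisations of the two model pairs (L2 Kummer-map merge)
    (H : Type u) [CommGroup H] [MulAction N.piRat H]
    [MulAction (MulAut (completion (GrpCat.of (Multiplicative ℤ)))) H]
    (κ : N.infκPair.KummerRealization H) (κx : N.infκxPair.KummerRealization H)
    -- LAW (a) Kummer naturality, both pairs ([IUTchI] Ex 5.1 (v) p.127 l.76 – p.128 l.2)
    (h_Ex51v_nat : ∀ e : CoricPair.Iso N.infκPair N.infκPair,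
      ∃ u : MulAut (completion (GrpCat.of (Multiplicative ℤ))),
        ∀ x : N.infκPair.carrier, κ.toFun (e.toEquiv x) = u • κ.toFun x)
    (h_Ex51v_natx : ∀ e : CoricPair.Iso N.infκxPair N.infκxPair,
      ∃ u : MulAut (completion (GrpCat.of (Multiplicative ℤ))),
        ∀ x : N.infκxPair.carrier, κx.toFun (e.toEquiv x) = u • κx.toFun x)
    -- DATA: orders at points ([AbsTopIII] Prop 1.6 (iii))
    {X : Type v} (ord : X → N.Krat → ℤ)
    -- LAW (b′) divisor transport, both pairs, on the `π₁^rat`-FIXED elements («Kummer classes of rational functions»)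
    (h_Ex51v_ord : ∀ (u : MulAut (completion (GrpCat.of (Multiplicative ℤ)))) (f f' : N.infκPair.carrier),
      (∀ g : N.piRat, g • (f : N.Krat) = f) → (∀ g : N.piRat, g • (f' : N.Krat) = f') →
      κ.toFun f' = u • κ.toFun f → ∀ x : X, u (eta (ord x f)) = eta (ord x f'))
    (h_Ex51v_ordx : ∀ (u : MulAut (completion (GrpCat.of (Multiplicative ℤ)))) (f f' : N.infκxPair.carrier),
      (∀ g : N.piRat, g • (f : N.Krat) = f) → (∀ g : N.piRat, g • (f' : N.Krat) = f') →
      κx.toFun f' = u • κx.toFun f → ∀ x : X, u (eta (ord x f)) = eta (ord x f'))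
    -- LAW Rmk 3.1.7 (i)/(ii): pole shape of invariant ∞κ×-coric functions (⊇ the ∞κ-coric ones, `minfκ_subset`);
    -- a `π₁^rat`-fixed ∞κ-coric function with two distinct zeroes (hence also an ∞κ×-coric one)
    (h_Ex51v_polex : ∀ f' ∈ N.Minfκx, (∀ g : N.piRat, g • f' = f') →
      ∀ x₁ x₂ : X, x₁ ≠ x₂ → ¬ (ord x₁ f' < 0 ∧ ord x₂ f' < 0))
    (h_Ex51v_zero : ∃ f ∈ N.Minfκ, (∀ g : N.piRat, g • f = f) ∧
      ∃ x₁ x₂ : X, x₁ ≠ x₂ ∧ 0 < ord x₁ f ∧ 0 < ord x₂ f)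
    -- LAW Rmk 3.1.7 (ii)/(iii) for E51/L23: `π₁^{rat/κ-sol}` moves some ∞κ×-coric function (a constant)
    (h_Ex51v_moves : ∃ g ∈ N.ratKsolKer, ∃ f ∈ N.Minfκx, g • f ≠ f)
    -- DATA + LAWS for E51/L27 (∞κ cyclotome comparison): (E)(T)(D) + Rmk 3.1.7
    (C : CyclotomeComparison.{u})
    (zμ : MulAut (completion (GrpCat.of (Multiplicative ℤ))) → (C.μ₁ ≃* C.μ₂) → (C.μ₁ ≃* C.μ₂))
    (h_Ex51v_zμ_one : ∀ e, zμ 1 e = e)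
    (twist : MulAut (completion (GrpCat.of (Multiplicative ℤ))) → C.H₂ → C.H₂)
    (h_Ex51v_E : ∃ e₀ : C.μ₁ ≃* C.μ₂, Set.BijOn (C.induced e₀) C.im₁ C.im₂)
    (h_Ex51v_T : ∀ e e' : C.μ₁ ≃* C.μ₂, ∃ u : MulAut (completion (GrpCat.of (Multiplicative ℤ))),
      e' = zμ u e ∧ ∀ h, C.induced e' h = twist u (C.induced e h))
    {Pt : Type v} (ordC : Pt → C.H₂ → ℤ)
    (h_Ex51v_D : ∀ u : MulAut (completion (GrpCat.of (Multiplicative ℤ))), Set.MapsTo (twist u) C.im₂ C.im₂ →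
      ∀ h ∈ C.im₂, ∀ x : Pt, u (eta (ordC x h)) = eta (ordC x (twist u h)))
    (h_Ex51v_Ctwo : ∃ h ∈ C.im₂, ∃ x₁ x₂ : Pt, x₁ ≠ x₂ ∧ 0 < ordC x₁ h ∧ 0 < ordC x₂ h)
    (h_Ex51v_Cone : ∀ h ∈ C.im₂, ∀ x₁ x₂ : Pt, x₁ ≠ x₂ → ¬ (ordC x₁ h < 0 ∧ ordC x₂ h < 0))
    -- DATA + LAWS for E51/L28 (`†𝕄^⊛` display, layers ⊛/sol/mod, integral submonoids): (E)(T)(V)(I)(P)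
    {𝔓 : Type w'} (Cf : CyclotomeComparisonFamily AstLayer 𝔓)
    (zμf : MulAut (completion (GrpCat.of (Multiplicative ℤ))) → (Cf.μ₁ ≃* Cf.μ₂) → (Cf.μ₁ ≃* Cf.μ₂))
    (h_Ex51v_zμf_one : ∀ e, zμf 1 e = e)
    (twistf : MulAut (completion (GrpCat.of (Multiplicative ℤ))) → Cf.H₂ → Cf.H₂)
    (h_Ex51v_fE : ∃ e, Cf.InducesCompatibleIsos e)
    (h_Ex51v_fT : ∀ e e' : Cf.μ₁ ≃* Cf.μ₂, ∃ u : MulAut (completion (GrpCat.of (Multiplicative ℤ))),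
      e' = zμf u e ∧ ∀ h, Cf.induced e' h = twistf u (Cf.induced e h))
    (val : 𝔓 → Cf.H₂ → ℤ)
    (h_Ex51v_fV : ∀ u : MulAut (completion (GrpCat.of (Multiplicative ℤ))),
      Set.MapsTo (twistf u) (Cf.im₂ AstLayer.mod) (Cf.im₂ AstLayer.mod) →
        ∀ h ∈ Cf.im₂ AstLayer.mod, ∀ 𝔭 : 𝔓, u (eta (val 𝔭 h)) = eta (val 𝔭 (twistf u h)))
    (h_Ex51v_fI : ∀ 𝔭 : 𝔓, ∀ h ∈ Cf.im₂ AstLayer.mod, h ∈ Cf.int₂ 𝔭 → 0 ≤ val 𝔭 h)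
    (h_Ex51v_fP : ∃ 𝔭₀ : 𝔓, ∃ h ∈ Cf.im₂ AstLayer.mod, h ∈ Cf.int₂ 𝔭₀ ∧ 0 < val 𝔭₀ h)
    -- DATA + LAW for E51/L31 (p.129 l.5–24; text of the author of record abc-iut-w5-d110, 4e919baf55567098): Kummer restriction
    -- data at [open subgroups of decomposition groups of] strictly critical points + the Rmk 3.1.7 (ii) torsion criterion
    -- («some [or, equivalently, every]») for the Kummer classes of the ∞κ×-coric functions
    (R : CriticalRestrictionData N.piRat H)
    (h_Ex51v_tors_some : ∀ f : N.infκxPair.carrier,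
      (f : N.Krat) ∈ N.Minfκ ↔ ∃ i : R.Idx, IsOfFinOrder (R.res i (κx.toFun f)))
    (h_Ex51v_tors_every : ∀ f : N.infκxPair.carrier,
      (f : N.Krat) ∈ N.Minfκ ↔ ∀ i : R.Idx, IsOfFinOrder (R.res i (κx.toFun f))) :
    -- CLOSED CONJUNCTS of node IUTchI:Ex5.1(v)
    ExistsUniqueCoricStructure N.piRat N.infκPair ∧                       -- E51/L29 (∞κ)  [F-2571-free: p431147]
    ExistsUniqueCoricStructure N.piRat N.infκxPair ∧                      -- E51/L29 (∞κ×)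
    UniqueCyclotomeIso C ∧                                                -- E51/L27
    UniqueCyclotomeIsoFamily Cf ∧                                         -- E51/L28
    (∀ P' : CoricPair N.piRat, IsCoricStructure N.piRat N.infκPair P' →   -- E51/L22
      P'.FactorsThrough N.ratKsolKer) ∧
    (∀ P' : CoricPair N.piRat, IsCoricStructure N.piRat N.infκxPair P' →  -- E51/L23
      ¬ P'.FactorsThrough N.ratKsolKer) ∧
    (∀ P' P'' : CoricPair N.piRat, ∀ (h : IsCoricStructure N.piRat N.infκPair P') -- E51/L26+L29, 2 structures
      (h' : IsCoricStructure N.piRat N.infκPair P''),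
      ∃! e : CoricPair.Iso P' P'',
        e.IsCompatible (CoricPair.KummerRealization.ofIso h.nonempty_iso.some κ)
          (CoricPair.KummerRealization.ofIso h'.nonempty_iso.some κ)) ∧
    N.minfκUnits ⊆ N.minfκxUnits ∧                                        -- E51/L30 (unconditional)
    CoricPair.DeterminesInfκStructure κx.toFun R N.infκPair :=            -- E51/L31 (NEW at v0.2)
  ⟨N.existsUniqueCoricStructure_infκPair_of_fixedDivisors κ h_Ex51v_nat ord h_Ex51v_ord
      (fun f' hf' hfix => h_Ex51v_polex f' (N.minfκ_subset hf') hfix) h_Ex51v_zero,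
    N.existsUniqueCoricStructure_infκxPair_of_divisors κx h_Ex51v_natx ord h_Ex51v_ordx h_Ex51v_polex
      (h_Ex51v_zero.imp fun _ hf => ⟨N.minfκ_subset hf.1, hf.2⟩),
    UniqueCyclotomeIso.of_laws C zμ h_Ex51v_zμ_one twist h_Ex51v_E h_Ex51v_T ordC h_Ex51v_D h_Ex51v_Ctwo
      h_Ex51v_Cone,
    UniqueCyclotomeIsoFamily.of_integral_laws Cf AstLayer.mod zμf h_Ex51v_zμf_one twistf h_Ex51v_fE h_Ex51v_fT
      val h_Ex51v_fV h_Ex51v_fI h_Ex51v_fP,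
    fun _ h => NFBridgeRecon.IsCoricStructure.factorsThrough_ratKsolKer N h,
    fun _ h => NFBridgeRecon.IsCoricStructure.not_factorsThrough_ratKsolKer N h h_Ex51v_moves,
    fun _ _ h h' => IsCoricStructure.existsUnique_iso κ h h',
    N.minfκUnits_subset,
    N.determinesInfκStructure_infκxPair_of_criterion κx.toFun R h_Ex51v_tors_some h_Ex51v_tors_every⟩

/-! ## (c) §2 held rows at the genuine 𝔛-datum, `hker` discharged -/

section Sec2V2

open scoped Pointwise
open Topology Literature.AnabelianGeometry.SemiGraphs

/-- **v0.2: [IUTchI] §2 held rows, `hker` DISCHARGED** — same conjuncts as v0.1's `layer5_held_sec2_v1` (abc-iut-L5-d5's reduced route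
`cor23_i_to_iv_ofSpecialFibre_reduced`, `TemperedCoveringsCor23OfSpecialFibreAllLevels.lean`) at the genuine 𝔛-datum
`StableCurveTemperedData.ofSpecialFibre …` (abc-iut-L5-t11), with the Cor 2.3 (ii) merge atom `hker` («`Ker(Δ̂_X ↠ Π̂_𝔾)` is the closure
of its intersection with `Δ^tp_X`», p.48 l.13–29) supplied by abc-iut-w4-d058's THEOREM
`StableCurveTemperedData.ofSpecialFibre_ker_ρHat_subset_closure` (p431082; the admissible quotient is an OPEN surjection, [SemiAnbd]
Ex. 3.10, and the kernel of a completed open surjection is the closure of the image of the kernel).  Law binders: h22 · hH · hOutTp ·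
hA' · hB' · hv · htp · hhat · h24i · h24ii = 10 (v0.1: 11; v0: 13).  DATA binders as before (the datum's parameters and a cusp `x`).
Closers BY NAME: `cor23_i_to_iv_ofSpecialFibre_reduced` (abc-iut-L5-d5), `cor23v_of_graph` (abc-iut-L5-d4), `cor23vi_of_graph`
(abc-iut-L5-d5), `cor25_ofSpecialFibre`, `prop24iii_ofSpecialFibre` (abc-iut-L5-t11).  Nothing here asserts that abc is proved or
refuted or takes a side on [IUTchIII] Cor. 3.12; a binder is an assumption label; typed ≠ discharged. -/
theorem layer5_held_sec2_v2
    {p : ℕ} [Fact p.Prime] (X : Literature.AnabelianGeometry.SemiGraphs.TemperedCurve p) (d : X.GroupLevelData)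
    (S : Literature.AnabelianGeometry.SemiGraphs.SpecialFibreData (X.toTemperedArithmeticGroup d)) (h36 : S.Gc.Prop36Hypotheses)
    (Sigma SigmaHat : Set ℕ) (hsub : Sigma ⊆ SigmaHat) (hne : Sigma.Nonempty)
    (hprime : ∀ q ∈ SigmaHat, q.Prime) (hp : p ∉ Sigma) (TpH : Subgroup S.chart.G)
    (HatH : Subgroup (TemperedGraphGroupData.exists_completion_of_prop36 S.Gc h36 S.chart).choose)
    (hle : TpH.map (TemperedGraphGroupData.exists_completion_of_prop36 S.Gc h36
      S.chart).choose_spec.choose.toMonoidHom ≤ HatH)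
    (cuspMeetsH : {x : X.Pt // X.IsCusp x} → Prop) (x : {x : X.Pt // X.IsCusp x})
    (h22 : (StableCurveTemperedData.ofSpecialFibre X d S h36 Sigma SigmaHat hsub hne hprime hp TpH HatH hle
      cuspMeetsH).graph.CommensuratorsOfDecompositionSubgroups)
    (hH : ((StableCurveTemperedData.ofSpecialFibre X d S h36 Sigma SigmaHat hsub hne hprime hp TpH HatH hle cuspMeetsH).graph.HatH :
        Set (StableCurveTemperedData.ofSpecialFibre X d S h36 Sigma SigmaHat hsub hne hprime hp TpH HatH hle cuspMeetsH).graph.Hat) =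
      closure ((StableCurveTemperedData.ofSpecialFibre X d S h36 Sigma SigmaHat hsub hne hprime hp TpH HatH hle cuspMeetsH).graph.ι ''
        (StableCurveTemperedData.ofSpecialFibre X d S h36 Sigma SigmaHat hsub hne hprime hp TpH HatH hle cuspMeetsH).graph.TpH))
    (hOutTp : ∀ g : (StableCurveTemperedData.ofSpecialFibre X d S h36 Sigma SigmaHat hsub hne hprime hp TpH HatH hle cuspMeetsH).PiTp,
      ∃ δ : (StableCurveTemperedData.ofSpecialFibre X d S h36 Sigma SigmaHat hsub hne hprime hp TpH HatH hle cuspMeetsH).DeltaTp,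
        MulAut.conj g • ((StableCurveTemperedData.ofSpecialFibre X d S h36 Sigma SigmaHat hsub hne hprime hp TpH HatH hle
            cuspMeetsH).deltaTpH.map
          (StableCurveTemperedData.ofSpecialFibre X d S h36 Sigma SigmaHat hsub hne hprime hp TpH HatH hle cuspMeetsH).DeltaTp.subtype) =
        MulAut.conj (δ : (StableCurveTemperedData.ofSpecialFibre X d S h36 Sigma SigmaHat hsub hne hprime hp TpH HatH hle
            cuspMeetsH).PiTp) •
          ((StableCurveTemperedData.ofSpecialFibre X d S h36 Sigma SigmaHat hsub hne hprime hp TpH HatH hle cuspMeetsH).deltaTpH.map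
            (StableCurveTemperedData.ofSpecialFibre X d S h36 Sigma SigmaHat hsub hne hprime hp TpH HatH hle cuspMeetsH).DeltaTp.subtype))
    (hA' : (∃ l ∈ SigmaHat, l ∉ Sigma ∧ l ≠ p) →
      ∀ W : Subgroup (StableCurveTemperedData.ofSpecialFibre X d S h36 Sigma SigmaHat hsub hne hprime hp TpH HatH hle cuspMeetsH).DeltaHat,
        W.Normal → IsOpen (W : Set (StableCurveTemperedData.ofSpecialFibre X d S h36 Sigma SigmaHat hsub hne hprime hp TpH HatH hle
          cuspMeetsH).DeltaHat) →
        ∀ a : (StableCurveTemperedData.ofSpecialFibre X d S h36 Sigma SigmaHat hsub hne hprime hp TpH HatH hle cuspMeetsH).DeltaHat,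
          (∀ x ∈ W, x ∈ (StableCurveTemperedData.ofSpecialFibre X d S h36 Sigma SigmaHat hsub hne hprime hp TpH HatH hle
            cuspMeetsH).ρHat.ker → a * x = x * a) → a ∈ W)
    (hB' : SigmaHat = {q | q.Prime} →
      ∀ W : Subgroup (StableCurveTemperedData.ofSpecialFibre X d S h36 Sigma SigmaHat hsub hne hprime hp TpH HatH hle cuspMeetsH).DeltaHat,
        W.Normal → IsOpen (W : Set (StableCurveTemperedData.ofSpecialFibre X d S h36 Sigma SigmaHat hsub hne hprime hp TpH HatH hle
          cuspMeetsH).DeltaHat) →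
        ∀ a : (StableCurveTemperedData.ofSpecialFibre X d S h36 Sigma SigmaHat hsub hne hprime hp TpH HatH hle cuspMeetsH).DeltaHat,
          (∀ x ∈ W, x ∈ (StableCurveTemperedData.ofSpecialFibre X d S h36 Sigma SigmaHat hsub hne hprime hp TpH HatH hle
            cuspMeetsH).ρHat.ker → a * x = x * a) → a ∈ W)
    (hv : ((StableCurveTemperedData.ofSpecialFibre X d S h36 Sigma SigmaHat hsub hne hprime hp TpH HatH hle cuspMeetsH).graph.HatH : Set (StableCurveTemperedData.ofSpecialFibre X d S h36 Sigma SigmaHat hsub hne hprime hp TpH HatH hle cuspMeetsH).graph.Hat) ∩ Set.range (StableCurveTemperedData.ofSpecialFibre X d S h36 Sigma SigmaHat hsub hne hprime hp TpH HatH hle cuspMeetsH).graph.ι =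
      (StableCurveTemperedData.ofSpecialFibre X d S h36 Sigma SigmaHat hsub hne hprime hp TpH HatH hle cuspMeetsH).graph.ι '' (StableCurveTemperedData.ofSpecialFibre X d S h36 Sigma SigmaHat hsub hne hprime hp TpH HatH hle cuspMeetsH).graph.TpH)
    (htp : ∀ x : (StableCurveTemperedData.ofSpecialFibre X d S h36 Sigma SigmaHat hsub hne hprime hp TpH HatH hle cuspMeetsH).Cusp, (StableCurveTemperedData.ofSpecialFibre X d S h36 Sigma SigmaHat hsub hne hprime hp TpH HatH hle cuspMeetsH).cuspMeetsH x →
      ∃ t : (StableCurveTemperedData.ofSpecialFibre X d S h36 Sigma SigmaHat hsub hne hprime hp TpH HatH hle cuspMeetsH).graph.Tp, ((StableCurveTemperedData.ofSpecialFibre X d S h36 Sigma SigmaHat hsub hne hprime hp TpH HatH hle cuspMeetsH).inertiaTp x).map (StableCurveTemperedData.ofSpecialFibre X d S h36 Sigma SigmaHat hsub hne hprime hp TpH HatH hle cuspMeetsH).ρTp ≤ MulAut.conj t • (StableCurveTemperedData.ofSpecialFibre X d S h36 Sigma SigmaHat hsub hne hprime hp TpH HatH hle cuspMeetsH).graph.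TpH)
    (hhat : ∀ x : (StableCurveTemperedData.ofSpecialFibre X d S h36 Sigma SigmaHat hsub hne hprime hp TpH HatH hle cuspMeetsH).Cusp,
      (∃ g : (StableCurveTemperedData.ofSpecialFibre X d S h36 Sigma SigmaHat hsub hne hprime hp TpH HatH hle cuspMeetsH).graph.Hat, (((StableCurveTemperedData.ofSpecialFibre X d S h36 Sigma SigmaHat hsub hne hprime hp TpH HatH hle cuspMeetsH).inertiaTp x).map (StableCurveTemperedData.ofSpecialFibre X d S h36 Sigma SigmaHat hsub hne hprime hp TpH HatH hle cuspMeetsH).ρTp).map (StableCurveTemperedData.ofSpecialFibre X d S h36 Sigma SigmaHat hsub hne hprime hp TpH HatH hle cuspMeetsH).graph.ι ≤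
        MulAut.conj g • (StableCurveTemperedData.ofSpecialFibre X d S h36 Sigma SigmaHat hsub hne hprime hp TpH HatH hle cuspMeetsH).graph.HatH) → (StableCurveTemperedData.ofSpecialFibre X d S h36 Sigma SigmaHat hsub hne hprime hp TpH HatH hle cuspMeetsH).cuspMeetsH x)
    (h24i : (StableCurveTemperedData.ofSpecialFibre X d S h36 Sigma SigmaHat hsub hne hprime hp TpH HatH hle cuspMeetsH).Prop24i)
    (h24ii : (StableCurveTemperedData.ofSpecialFibre X d S h36 Sigma SigmaHat hsub hne hprime hp TpH HatH hle cuspMeetsH).Prop24ii) :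
    (StableCurveTemperedData.ofSpecialFibre X d S h36 Sigma SigmaHat hsub hne hprime hp TpH HatH hle cuspMeetsH).Cor23i ∧ (StableCurveTemperedData.ofSpecialFibre X d S h36 Sigma SigmaHat hsub hne hprime hp TpH HatH hle cuspMeetsH).Cor23ii ∧ (StableCurveTemperedData.ofSpecialFibre X d S h36 Sigma SigmaHat hsub hne hprime hp TpH HatH hle cuspMeetsH).Cor23iii ∧ (StableCurveTemperedData.ofSpecialFibre X d S h36 Sigma SigmaHat hsub hne hprime hp TpH HatH hle cuspMeetsH).Cor23iv ∧ (StableCurveTemperedData.ofSpecialFibre X d S h36 Sigma SigmaHat hsub hne hprime hp TpH HatH hle cuspMeetsH).Cor23v ∧ (StableCurveTemperedData.ofSpecialFibre X d S h36 Sigma SigmaHat hsub hne hprime hp TpH HatH hle cuspMeetsH).Cor23vi ∧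
    ((StableCurveTemperedData.ofSpecialFibre X d S h36 Sigma SigmaHat hsub hne hprime hp TpH HatH hle cuspMeetsH).Cor25Decomposition ∧ (StableCurveTemperedData.ofSpecialFibre X d S h36 Sigma SigmaHat hsub hne hprime hp TpH HatH hle cuspMeetsH).Cor25Inertia) ∧ (StableCurveTemperedData.ofSpecialFibre X d S h36 Sigma SigmaHat hsub hne hprime hp TpH HatH hle cuspMeetsH).Prop24iii :=
  haveI : Nonempty X.Pt := ⟨x.1⟩
  haveI : Nonempty {x : X.Pt // X.IsCusp x} := ⟨x⟩
  have h14 := StableCurveTemperedData.cor23_i_to_iv_ofSpecialFibre_reduced X d S h36 Sigma SigmaHat hsub hne hprime hp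
    TpH HatH hle cuspMeetsH h22 hH
    (StableCurveTemperedData.ofSpecialFibre_ker_ρHat_subset_closure X d S h36 Sigma SigmaHat hsub hne hprime hp TpH HatH
      hle cuspMeetsH)  -- `hker` DISCHARGED (abc-iut-w4-d058, p431082)
    hOutTp hA' hB'
  ⟨h14.1, h14.2.1, h14.2.2.1, h14.2.2.2, (StableCurveTemperedData.ofSpecialFibre X d S h36 Sigma SigmaHat hsub hne hprime hp TpH HatH hle cuspMeetsH).cor23v_of_graph hv,
    (StableCurveTemperedData.ofSpecialFibre X d S h36 Sigma SigmaHat hsub hne hprime hp TpH HatH hle cuspMeetsH).cor23vi_of_graph htp hhat,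
    StableCurveTemperedData.cor25_ofSpecialFibre X d S h36 Sigma SigmaHat hsub hne hprime hp TpH HatH hle cuspMeetsH h24i h24ii,
    StableCurveTemperedData.prop24iii_ofSpecialFibre X d S h36 Sigma SigmaHat hsub hne hprime hp TpH HatH hle cuspMeetsH x h24i⟩


end Sec2V2

/-! ## The single top of record v2 -/

/-- **THE LAYER-5 CERTIFICATE v2 — SINGLE TOP OF RECORD** (abc-iut-L5-lead GO 07:39:57Z; LAYER5-CERT-SPEC §7): the conjunction, BY NAME via
`StatementOf`, of the v1 top `layer5_of_S_v1` (`Conditional/Layer5OfSEx51.lean`: v0's `layer5_of_S`, the companion's `layer5_held_cor12`,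
`layer5_held_ex51v`, `layer5_held_ex51i_L11`, `layer5_held_sec2_v1` — all still available at their v0/v0.1 strength) and this module's
three WEAKENED restatements `layer5_held_cor56i_ref` (Cor 5.6 (i), `hcan ↦ hHT`, ERRATUM F-d5-1) · `layer5_held_ex51v_v2` (Ex 5.1 (v),
FACT F-2571 removed, `h_Ex51v_pole`/`h_Ex51v_zerox` derived, + E51/L31) · `layer5_held_sec2_v2` (§2 rows, `hker` discharged).
CENSUS v2 (binders inside the conjuncts, none at top level; most-reduced routes): CONE 47 · FACT 0 · datum side-conditions 8
(v1: CONE 48 · FACT 1) — nodes 139 (claim-proved 47 · data 56 · held/pending 36 [conjoined 16 · not typable / settled 20]); sub-DAG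
row E51/L31 newly conjoined.  S-FREE.  Nothing here asserts that abc is proved or refuted or takes a side on [IUTchIII] Cor. 3.12; a
binder is an assumption label; typed ≠ discharged; indexed ≠ endorsed. -/
theorem layer5_of_S_v2 :
    Summit.ABC.IUTFork.DAG.PartL5a.StatementOf @layer5_of_S_v1 ∧
    Summit.ABC.IUTFork.DAG.PartL5a.StatementOf @layer5_held_cor56i_ref ∧
    Summit.ABC.IUTFork.DAG.PartL5a.StatementOf @layer5_held_ex51v_v2 ∧
    Summit.ABC.IUTFork.DAG.PartL5a.StatementOf @layer5_held_sec2_v2 :=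
  ⟨@layer5_of_S_v1, @layer5_held_cor56i_ref, @layer5_held_ex51v_v2, @layer5_held_sec2_v2⟩

end Summit.ABC.IUTFork.Conditional

/-! ### Build-lane export guard (ops-buildfix bf1-g30, 2026-08-28; G11b-3 recipe v2 as in `GelbartRogawski1991/UnitaryDualPairSeesawCharacter`):
the theorems of this file carry very large dependent telescopes; at `.olean` export Lean 4.32's library-suggestion indexers fold over
every local theorem statement and do not finish within the build lane's one-hour clock (measured on a farm node: `lean -o` > 1 500 s, plain
elaboration ≈ 20 s). ONE file-final `local` `[implicit_reducible]` keeps them out of that premise index (inert for Meta and the kernel on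
theorems; no definition is tagged; statements and proofs unchanged). -/
set_option allowUnsafeReducibility true in
attribute [local implicit_reducible]
  _root_.Summit.ABC.IUTFork.Conditional.layer5_held_cor56i_ref
  _root_.Summit.ABC.IUTFork.Conditional.layer5_held_ex51v_v2
  _root_.Summit.ABC.IUTFork.Conditional.layer5_held_sec2_v2 _root_.Summit.ABC.IUTFork.Conditional.layer5_of_S_v2
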